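import Literature.Analysis.FluidPDE.ElgindiBlowupContinuationProofs
import Literature.Analysis.FluidPDE.AxisymmetricLiftR5
import HarnessLib

/-!
# The `C^{1,1/3}` threshold for axisymmetric swirl-free Euler flows on `ℝ³`

Topic `Literature/Analysis/FluidPDE`. The regularity exponent `α = 1/3` separates, inside the class
of axisymmetric solutions WITHOUT swirl of the incompressible Euler equations on `ℝ³` with velocity
`u ∈ C^{1,α}(ℝ³) ∩ L²(ℝ³)`, a globally regular regime (`α > 1/3`) from a regime where finite-time
singularities are constructed (`α` small: Elgindi, Elgindi–Ghoul–Masmoudi, Córdoba–Martínez-Zoroa–Zheng;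
all `α < 1/3`: Shkoller 2026 and Chen 2026, preprints — the latter with exact `C^α` self-similar
profiles for every `α ∈ (0, 1/3)`, arXiv:2605.15130 Thms 1.1–1.2, not vendored here). This file records the two sides as named statements in the
tree's Hölder–Euler vocabulary (`MemC1Holder`, `HasFiniteEnergy`, `IsAxisymmetric`, `HasNoSwirl`,
`IsClassicalEulerOnDomain`, `IsHolderEulerSolution` of `ElgindiBlowupContinuationProofs.lean`) and proves
the elementary consequences. Nothing here concerns the Navier–Stokes equations: with viscosity the
swirl-free class is globally regular for smooth data (tree: `axisymmetric_no_swirl_global_regularity`,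
discharged), whatever `α`.

## Sources ("p." = chunk of the held text)

* `[Danchin2007]` R. Danchin, *Axisymmetric incompressible flows with bounded vorticity*, Russian Math.
  Surveys 62:3 (2007) 475–496 (paywalled, acquisition request acq-11426; cited through the two
  restatements below): global existence and uniqueness for axisymmetric swirl-free data with
  `ω₀ ∈ L^{3,1} ∩ L^∞`, `ω₀/r ∈ L^{3,1}` (Lorentz space), restated in [AbidiHmidiKeraani2009] §1,
  p. 3 ("In a recent work [rd], Danchin has weakened the Ukhoviskii and Yudovich conditions. More
  precisely, he obtains global existence and uniqueness for initial data `ω₀ ∈ L^{3,1} ∩ L^∞` and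
  `ω₀/r ∈ L^{3,1}`") and in arXiv:2512.13456 §1 p. 3.
* `[AbidiHmidiKeraani2009]` H. Abidi, T. Hmidi, S. Keraani, Math. Ann. 347 (2010) = arXiv:0801.2316,
  **Thm 1.1** (p. 3): "Assume `p ∈ [1, ∞]`. Let `u₀` be an axisymmetric divergence free vector field
  belonging to `B^{1+3/p}_{p,1}`, such that its vorticity satisfies `ω₀/r ∈ L^{3,1}`. Then the system
  (E) has a unique global solution `u ∈ C(ℝ₊; B^{1+3/p}_{p,1})`" (axisymmetric = without swirl in
  that paper, §1 p. 3), with the global a-priori bounds of §4, p. 9: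
  `‖ω(t)‖_{L^∞} ≲ ‖ω₀‖_{L^∞} exp(Ct‖ω₀/r‖_{L^{3,1}})`,
  `‖u(t)‖_{L^∞} ≲ (‖u₀‖_{L^∞} + ‖ω₀‖_{L^∞}) exp exp(Ct‖ω₀/r‖_{L^{3,1}})`.
* `[Shkoller2026]` S. Shkoller, *Incompressible Euler blowup at the `C^{1,1/3}` threshold*,
  arXiv:2603.10945 (March 2026; PREPRINT, unrefereed — tagged as a claim): §1.2 p. 3 ("a rigidity
  result of Saint-Raymond [SaintRaymond1994] (see also Danchin [Danchin2007] for the sharpest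
  formulation) shows that axisymmetric no-swirl solutions with finite energy are globally regular
  when `u ∈ C^{1,α}` with `α > 1/3`"), §1.6 **Thm 1.1** (Target Profile) and **Thm 1.2** (open-set
  stability) p. 4–5, Def. 5.2 and Lemma 5.3 p. 12–13 (the data: `ω_{θ,0}(R,σ) =
  −Γ R^α (1+R²)^{−γ/2} Θ(σ)`, `Θ` odd about the equator, so NOT compactly supported; `u₀ ∈ C^{1,α} ∩ L²`),
  §1.7 p. 5 ("Why an Eulerian self-similar ansatz breaks down near `α = 1/3`").
* `[Elgindi2021]` T. M. Elgindi, Ann. of Math. 194 (2021) = arXiv:1904.04795, Remark 1.5 p. 4: "all the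
  available global regularity results seem to require the velocity field to be at least `C^{1,1/3+}`
  smooth. Heuristics suggest that this regularity threshold is actually sharp".
* `[CordobaMartinezzoroaZheng2023]` Ann. PDE 11 (2025) = arXiv:2308.12197, Remark 6 p. 5: "It is an
  open question whether one can reach the `1/3` threshold".
* ERRATUM (2026 print, added after acceptance of this file). The endpoint `α = 1/3` is no longer
  open on the regular side: `[ShaoWeiZhang2026]` F. Shao, D. Wei, Z. Zhang, Acta Math. Sin. (Engl.
  Ser.) 42 (2026) 663–679 prove "global regularity for solutions with `C_c^α` initial vorticity when
  `α ≥ 1/3`", as restated in `[Chen2026HolderEulerSelfSimilarII]` J. Chen, arXiv:2605.15130, §1 p. 3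
  ("independently obtained by the author and Shao–Wei–Zhang … using the critical conserved quantity
  `‖r⁻¹ω^θ‖_{L^{3,∞}}`"), whose Abstract p. 2 reads "This blowup result is sharp in view of the
  global regularity theory for axisymmetric Euler without swirl with `C_c^α` initial vorticity for all
  `α ≥ 1/3`" and whose Thm 1.1 / Thm 1.2 (p. 5) give exact `C^α` self-similar profiles and
  asymptotically self-similar blow-up from `C_c^α` vorticity, `C^{1,α} ∩ L²` velocity, for every
  `α ∈ (0, 1/3)`. Neither 2026 statement is vendored in this file; the sentences below that call the
  endpoint "open" record the state of [CordobaMartinezzoroaZheng2023] Remark 6 only.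

## What is stated, and how it is rendered

* `Danchin2007.noSwirlHolderGlobal` (named fact, established): for `1/3 < γ < 1`, every
  `u₀ ∈ C^{1,γ}(ℝ³)` that is divergence free, axisymmetric without swirl, of finite energy and with
  compactly supported vorticity launches a GLOBAL solution of the tree's Hölder–Euler class
  `IsHolderEulerSolution γ (Ici 0) u₀` (classical, `C^{1,γ}` slices with finite energy and compactly
  supported vorticity, `C^{1,γ}` norms bounded on every `[0, T]`). This is the `C^{1,α}`, `α > 1/3`
  corollary as printed in [Shkoller2026] §1.2 and [Elgindi2021] Remark 1.5, of [Danchin2007] /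
  [AbidiHmidiKeraani2009] Thm 1.1 (case `p = ∞`): for such `u₀` the vorticity `ω₀ = ω_θ e_θ` is
  `C^γ`, purely azimuthal and continuous, hence vanishes on the axis and `|ω_θ| ≤ [ω₀]_γ r^γ`, so
  `ω₀/r = O(r^{γ−1})` on a compact set lies in the Lorentz space `L^{3,1}(ℝ³)` exactly when
  `3(1−γ) < 2`, i.e. `γ > 1/3`; and `C^{1,γ} ∩ L^∞ ⊂ B¹_{∞,1}`. The printed global solution is
  Lipschitz in space locally uniformly in time (`B¹_{∞,1} ⊂ W^{1,∞}`, bound of §4 p. 9), so the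
  Beale–Kato–Majda integral stays finite on bounded intervals and the maximal `C^{1,γ}` solution of
  Majda–Bertozzi Thm 4.3 (tree: `MajdaBertozzi2002_holderEulerBKM`, discharged) is global
  (classical solutions with bounded vorticity are unique, Yudovich). The compact-support and
  finite-energy clauses are those of the tree's class, narrower than print.
* `Shkoller2026.noSwirlTypeIBlowup` (CLAIM, under review): Thm 1.2 ⊇ Thm 1.1 rendered
  existentially — for every `0 < α < 1/3` there is a datum `u₀ ∈ C^{1,α}(ℝ³) ∩ L²(ℝ³)`, divergence
  free, axisymmetric without swirl and mirror-symmetric in `z` (`u₀(Sx) = S u₀(x)` for the reflection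
  `S = reflC 2`, i.e. `u_z` odd and `u_r` even in `z` — Def. 5.2), and a classical Euler solution
  from it on some `[0, T*)`, `0 < T* < ∞`, with slices in the same class, whose vorticity maximum and
  axial strain at the stagnation point `0` obey the two-sided Type-I law
  `c/(T*−t) ≤ ‖ω(t)‖_{L^∞}, −∂_z u_z(0,t) ≤ C/(T*−t)` for `t` near `T*`. Not rendered: uniqueness
  ("the corresponding unique local Euler solution"), the Lagrangian Jacobian law
  `J(t) ∼ (Γ(T*−t))^{1/(1−3α)}`, the open-set structure of the admissible class `𝒜_{α,γ}(ν,η)`.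
* Proved: the Type-I lower bound gives vorticity blow-up at `T*` in the tree's sense
  (`Shkoller2026.vorticityBlowsUpAt_of_typeI_lower`), so the claim yields, for every `α < 1/3`, a
  swirl-free `C^{1,α} ∩ L²` Euler blow-up (`Shkoller2026.noSwirlTypeIBlowup.exists_blowup`); and the
  trichotomy bookkeeping `holderExponent_trichotomy_third` used by readers of the two statements;
  `Danchin2007.noSwirlHolderGlobal.exists_on_Ico` restricts the global solution to finite windows.

## What is deliberately NOT here

Lorentz spaces and the `L^{3,1}` form of Danchin's theorem (no Lorentz spaces on `ℝ³` in the tree);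
Saint-Raymond 1994 (CPDE 19) and Ukhovskii–Yudovich 1968 (the `H^s` forms); the endpoint `α = 1/3`
(asked in [CordobaMartinezzoroaZheng2023] Remark 6; regular for `C_c^{1/3}` vorticity by
[ShaoWeiZhang2026] and [Chen2026HolderEulerSelfSimilarII] §1 — see the ERRATUM above); the 2026
self-similar profiles of [Chen2026HolderEulerSelfSimilarII]; anything about viscosity.
-/

noncomputable section

open MeasureTheory Set Function Filter
open _root_.Topology
open scoped NNReal ENNReal

namespace Literature.Analysis.FluidPDE

/-! ### The regular side: `α > 1/3` -/

namespace Danchin2007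

/-- **Global regularity of swirl-free axisymmetric `C^{1,γ}` Euler flows for `γ > 1/3`**
(Danchin, Russian Math. Surveys 62 (2007): global existence and uniqueness for axisymmetric
swirl-free data with `ω₀ ∈ L^{3,1} ∩ L^∞`, `ω₀/r ∈ L^{3,1}`, as restated in Abidi–Hmidi–Keraani,
Math. Ann. 347 (2010) §1 p. 3 and sharpened there to critical Besov data, Thm 1.1 (p. 3, case
`p = ∞`: `u₀ ∈ B¹_{∞,1}` axisymmetric divergence free with `ω₀/r ∈ L^{3,1}` ⟹ a unique global
solution `u ∈ C(ℝ₊; B¹_{∞,1})`, with `‖ω(t)‖_∞ ≲ ‖ω₀‖_∞ exp(Ct‖ω₀/r‖_{L^{3,1}})`, §4 p. 9); the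
`C^{1,α}`, `α > 1/3` form is the one printed in Shkoller, arXiv:2603.10945 §1.2 p. 3 — "axisymmetric
no-swirl solutions with finite energy are globally regular when `u ∈ C^{1,α}` with `α > 1/3`" — and in
Elgindi, Ann. of Math. 194 (2021) Remark 1.5). **Rendering** (the tree's Hölder–Euler class; see the
module docstring for the dictionary `C^{1,γ}`, compactly supported swirl-free vorticity, `γ > 1/3` ⟹
`ω₀/r ∈ L^{3,1}`, and for the continuation of `C^{1,γ}` regularity by the Beale–Kato–Majda criterion):
for `1/3 < γ < 1` and `u₀ : ℝ³ → ℝ³` of class `C^{1,γ}`, divergence free, with compactly supported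
vorticity and finite energy, axisymmetric and without swirl, there is a global classical solution
`(u, p)` of the incompressible Euler equations on `ℝ³ × [0, ∞)` with `u(0) = u₀` in the class
`IsHolderEulerSolution γ (Ici 0) u₀`. [cite: AbidiHmidiKeraani2009, Thm 1.1 (p. 3 of arXiv:0801.2316, case p = ∞) with §1 p. 3 (Danchin's theorem) and §4 p. 9 (global vorticity bound)]
[cite: Danchin2007, main theorem (cite-only, acq-11426; restated in AbidiHmidiKeraani2009 §1)]
[cite: Shkoller2026, §1.2 (p. 3): the C^{1,α}, α > 1/3 statement] -/
def noSwirlHolderGlobal : Prop :=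
  ∀ (γ : ℝ≥0) (_hγ : (1 : ℝ) / 3 < γ) (_hγ1 : γ < 1)
    (u₀ : EuclideanSpace ℝ (Fin 3) → EuclideanSpace ℝ (Fin 3)) (_hreg : MemC1Holder γ u₀)
    (_hdiv : VectorCalculus.IsDivFree u₀) (_hsupp : HasCompactSupport (curl u₀))
    (_hener : HasFiniteEnergy u₀) (_hax : IsAxisymmetric u₀) (_hsw : HasNoSwirl u₀),
    ∃ (u : ℝ → EuclideanSpace ℝ (Fin 3) → EuclideanSpace ℝ (Fin 3))
      (p : ℝ → EuclideanSpace ℝ (Fin 3) → ℝ), IsHolderEulerSolution γ (Ici 0) u₀ u p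

/-- Under the fact, a `C^{1,γ}` swirl-free axisymmetric datum with `γ > 1/3` has a classical Euler
solution on every finite window `[0, T)` (restriction of the global one; bookkeeping for readers who
quantify over bounded time sets). [cite: AbidiHmidiKeraani2009, Thm 1.1 (p. 3)] -/
theorem noSwirlHolderGlobal.exists_on_Ico (h : noSwirlHolderGlobal) {γ : ℝ≥0} (hγ : (1 : ℝ) / 3 < γ)
    (hγ1 : γ < 1) {u₀ : EuclideanSpace ℝ (Fin 3) → EuclideanSpace ℝ (Fin 3)} (hreg : MemC1Holder γ u₀)
    (hdiv : VectorCalculus.IsDivFree u₀) (hsupp : HasCompactSupport (curl u₀))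
    (hener : HasFiniteEnergy u₀) (hax : IsAxisymmetric u₀) (hsw : HasNoSwirl u₀) (T : ℝ) :
    ∃ (u : ℝ → EuclideanSpace ℝ (Fin 3) → EuclideanSpace ℝ (Fin 3))
      (p : ℝ → EuclideanSpace ℝ (Fin 3) → ℝ),
      IsClassicalEulerOnDomain (Ico 0 T) (⊤ : TopologicalSpace.Opens (EuclideanSpace ℝ (Fin 3))) 0 0 u p ∧
        u 0 = u₀ ∧ ∀ t ∈ Ico 0 T, MemC1Holder γ (u t) ∧ HasFiniteEnergy (u t) := by
  obtain ⟨u, p, hsol⟩ := h γ hγ hγ1 u₀ hreg hdiv hsupp hener hax hsw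
  have hsub : Ico (0 : ℝ) T ⊆ Ici 0 := fun t ht => ht.1
  refine ⟨u, p, ?_, hsol.initial, fun t ht => ⟨(hsol.slice t (hsub ht)).1, (hsol.slice t (hsub ht)).2.1⟩⟩
  exact hsol.euler.mono hsub (uniqueDiffOn_Ico 0 T)

end Danchin2007

/-! ### The singular side below the threshold: Shkoller's claim, every `α ∈ (0, 1/3)` -/

namespace Shkoller2026

/-- **Two-sided Type-I law near `T`** for a time-dependent field `ω` and a scalar `s` (the printed
shape `c/(T−t) ≤ ‖ω(·,t)‖_{L^∞}, s(t) ≤ C/(T−t)` of Shkoller's Thms 1.1–1.2, written without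
suprema: every value is `≤ C/(T−t)` and some value is `≥ c/(T−t)`), holding on a final window
`[t₁, T)`. [cite: Shkoller2026, Thm 1.1 / Thm 1.2 (p. 4–5 of arXiv:2603.10945): the displayed two-sided bounds] -/
def HasTypeIRateNear (ω : ℝ → EuclideanSpace ℝ (Fin 3) → EuclideanSpace ℝ (Fin 3)) (s : ℝ → ℝ)
    (T : ℝ) : Prop :=
  ∃ c C : ℝ, 0 < c ∧ c ≤ C ∧ ∃ t₁ ∈ Ico 0 T, ∀ t ∈ Ico t₁ T,
    (∀ x, ‖ω t x‖ ≤ C / (T - t)) ∧ (∃ x, c / (T - t) ≤ ‖ω t x‖) ∧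
      c / (T - t) ≤ s t ∧ s t ≤ C / (T - t)

/-- The axial strain at the origin, `−∂_z u_z(0)`: minus the `z`-component of the derivative of `v`
at `0` in the direction `e_z` (Shkoller's `−∂_z u_z(0,0,t)` at the stagnation point). [cite: Shkoller2026, Thm 1.1 (p. 4): the quantity −∂_z u_z(0,0,t)] -/
def axialStrainAtOrigin (v : EuclideanSpace ℝ (Fin 3) → EuclideanSpace ℝ (Fin 3)) : ℝ :=
  -(fderiv ℝ v 0 (EuclideanSpace.single (2 : Fin 3) (1 : ℝ))) 2

/-- **Shkoller's `C^{1,α}` blow-up for every `α ∈ (0, 1/3)` — a CLAIM (arXiv:2603.10945, March 2026,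
unrefereed).** Printed Thm 1.2 (p. 5; Thm 1.1 is the case `h ≡ 0`): "We fix `α ∈ (0, 1/3)` and
`η > 0`. There exist `γ > α + 5/2` and constants `Γ₀ = Γ₀(α,γ) > 0`, `ν₀ = ν₀(α,γ,η) > 0`, such
that the following holds. For any `0 < Γ ≤ Γ₀` and any axisymmetric no-swirl initial datum
`u₀ ∈ C^{1,α}(ℝ³) ∩ L²(ℝ³)`, odd in `z`, whose angular vorticity belongs to the admissible class
`𝒜_{α,γ}(ν,η)` (Definition 5.2) with `0 < ν ≤ ν₀`, the corresponding unique local Euler solution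
develops a finite-time singularity at some `T* < ∞` at the stagnation point `(r,z) = (0,0)`.
Moreover, the singularity is Type–I …: there exist constants `0 < c < C` (depending only on
`α, γ, η`) such that as `t ↑ T*`, `c/(T*−t) ≤ ‖ω(·,t)‖_{L^∞(ℝ³)} ≤ C/(T*−t)`,
`c/(T*−t) ≤ −∂_z u_z(0,0,t) ≤ C/(T*−t)` … In particular `∫₀^{T*} ‖ω(·,t)‖_{L^∞} dt = ∞`."
Def. 5.2 (p. 12): the class is non-empty (it contains the Target Profile datum,
`ω_{θ,0} = −Γ R^α(1+R²)^{−γ/2} Θ*(σ)`, `Θ*(σ) = (sin σ)^α Υ(σ)` extended oddly about the equator),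
and Lemma 5.3 (b): that datum has `u₀ ∈ C^{1,α}(ℝ³) ∩ L²(ℝ³)`; "odd in `z` (i.e.
`u_z(r,−z) = −u_z(r,z)` and `u_r(r,−z) = u_r(r,z)`)". **Rendering (existential, see the module
docstring):** for every `0 < α < 1/3` there are such a datum — `C^{1,α}`, finite energy, divergence
free, axisymmetric, swirl-free, mirror-symmetric in `z` (`u₀ (reflC 2 x) = reflC 2 (u₀ x)`) — a time
`0 < T`, and a classical solution `(u, p)` of the incompressible Euler equations (`f = 0`) on
`ℝ³ × [0, T)` with `u(0) = u₀`, slices `C^{1,α}` with finite energy, axisymmetric and swirl-free, whose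
vorticity and axial strain at the origin obey the two-sided Type-I law near `T`
(`HasTypeIRateNear`). The vorticity is NOT compactly supported (algebraic tail), so the tree's class
`IsHolderEulerSolution` is not used. Not rendered: uniqueness, the Jacobian law
`J(t) ∼ (Γ(T*−t))^{1/(1−3α)}`, open-set stability. [claim: Shkoller2026, status: under-review]
[cite: Shkoller2026, Thm 1.2 and Thm 1.1 (p. 4–5 of arXiv:2603.10945); Def. 5.2 and Lemma 5.3 (p. 12–13)] -/
def noSwirlTypeIBlowup : Prop :=
  ∀ α : ℝ≥0, 0 < α → (α : ℝ) < 1 / 3 →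
    ∃ u₀ : EuclideanSpace ℝ (Fin 3) → EuclideanSpace ℝ (Fin 3),
      MemC1Holder α u₀ ∧ HasFiniteEnergy u₀ ∧ VectorCalculus.IsDivFree u₀ ∧
      IsAxisymmetric u₀ ∧ HasNoSwirl u₀ ∧ (∀ x, u₀ (reflC 2 x) = reflC 2 (u₀ x)) ∧
      ∃ T : ℝ, 0 < T ∧
        ∃ (u : ℝ → EuclideanSpace ℝ (Fin 3) → EuclideanSpace ℝ (Fin 3))
          (p : ℝ → EuclideanSpace ℝ (Fin 3) → ℝ),
          IsClassicalEulerOnDomain (Ico 0 T) (⊤ : TopologicalSpace.Opens (EuclideanSpace ℝ (Fin 3)))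
              0 0 u p ∧
            u 0 = u₀ ∧
            (∀ t ∈ Ico 0 T, MemC1Holder α (u t) ∧ HasFiniteEnergy (u t) ∧
              IsAxisymmetric (u t) ∧ HasNoSwirl (u t)) ∧
            HasTypeIRateNear (fun t => curl (u t)) (fun t => axialStrainAtOrigin (u t)) T

/-- A Type-I LOWER bound `c/(T−t) ≤ ‖ω(t, x_t)‖` on a final window forces vorticity blow-up at `T`
in the tree's sense (`VorticityBlowsUpAt`: for every `M`, frequently as `t ↑ T` some value exceeds
`M`); in fact the exceedance holds for all `t` close to `T`. [cite: Shkoller2026, Thm 1.1 (p. 4): "In particular ∫₀^{T*}‖ω‖_{L^∞} dt = ∞"] -/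
theorem vorticityBlowsUpAt_of_typeI_lower
    {u : ℝ → EuclideanSpace ℝ (Fin 3) → EuclideanSpace ℝ (Fin 3)} {T c t₁ : ℝ} (hc : 0 < c)
    (ht₁ : t₁ < T) (h : ∀ t ∈ Ico t₁ T, ∃ x, c / (T - t) ≤ ‖curl (u t) x‖) :
    VorticityBlowsUpAt u T := by
  intro M
  -- the window `(max t₁ (T - c/(max M 0 + 1)), T)` lies in `𝓝[<] T`
  have hM1 : 0 < max M 0 + 1 := by positivity
  set δ : ℝ := c / (max M 0 + 1) with hδ
  have hδpos : 0 < δ := div_pos hc hM1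
  have hwin : ∀ᶠ t in 𝓝[<] T, t ∈ Ioo (max t₁ (T - δ)) T :=
    Ioo_mem_nhdsLT (max_lt ht₁ (by linarith))
  refine (hwin.mono fun t ht => ?_).frequently
  have ht₁t : t₁ ≤ t := (le_max_left _ _).trans ht.1.le
  have hTt : 0 < T - t := by linarith [ht.2]
  have hTtδ : T - t < δ := by linarith [(le_max_right t₁ (T - δ)).trans_lt ht.1]
  obtain ⟨x, hx⟩ := h t ⟨ht₁t, ht.2⟩
  refine ⟨x, lt_of_lt_of_le ?_ hx⟩
  -- `M < max M 0 + 1 = c/δ < c/(T - t)`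
  have h1 : M < max M 0 + 1 := (le_max_left M 0).trans_lt (lt_add_one _)
  have h2 : max M 0 + 1 = c / δ := by
    rw [hδ, div_div_cancel₀ hc.ne']
  have h3 : c / δ < c / (T - t) := div_lt_div_of_pos_left hc hTt hTtδ
  linarith

/-- From the claim: for every `0 < α < 1/3` there is a swirl-free axisymmetric `C^{1,α} ∩ L²` classical
Euler flow on `ℝ³ × [0, T)`, `T > 0`, whose vorticity blows up at `T` (the tree's
`VorticityBlowsUpAt`). [cite: Shkoller2026, Thm 1.2 (p. 5)] -/
theorem noSwirlTypeIBlowup.exists_blowup (h : noSwirlTypeIBlowup) {α : ℝ≥0} (hα : 0 < α)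
    (hα3 : (α : ℝ) < 1 / 3) :
    ∃ (T : ℝ) (u : ℝ → EuclideanSpace ℝ (Fin 3) → EuclideanSpace ℝ (Fin 3))
      (p : ℝ → EuclideanSpace ℝ (Fin 3) → ℝ), 0 < T ∧
      IsClassicalEulerOnDomain (Ico 0 T) (⊤ : TopologicalSpace.Opens (EuclideanSpace ℝ (Fin 3))) 0 0 u p ∧
      (∀ t ∈ Ico 0 T, MemC1Holder α (u t) ∧ HasFiniteEnergy (u t) ∧
        IsAxisymmetric (u t) ∧ HasNoSwirl (u t)) ∧
      VorticityBlowsUpAt u T := by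
  obtain ⟨u₀, -, -, -, -, -, -, T, hT, u, p, hsol, -, hslice, c, C, hc, -, t₁, ht₁, hrate⟩ :=
    h α hα hα3
  exact ⟨T, u, p, hT, hsol, hslice,
    vorticityBlowsUpAt_of_typeI_lower hc ht₁.2 fun t ht => (hrate t ht).2.1⟩

end Shkoller2026

/-! ### Bookkeeping: the two regimes cover every `α ∈ (0, 1) ∖ {1/3}` -/

/-- Trichotomy of the Hölder exponent against the threshold `1/3` (readers of the two statements
above case on it; the endpoint `α = 1/3` — asked in Córdoba–Martínez-Zoroa–Zheng 2023, Remark 6 — is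
regular for `C_c^{1/3}` vorticity by Shao–Wei–Zhang, Acta Math. Sin. 42 (2026), as restated in Chen,
arXiv:2605.15130 §1 p. 3; neither endpoint statement is vendored here).
[cite: CordobaMartinezzoroaZheng2023, Remark 6 (p. 5 of arXiv:2308.12197)]
[cite: Chen2026HolderEulerSelfSimilarII, §1 (p. 2–3 of arXiv:2605.15130): the endpoint and ShaoWeiZhang2026] -/
theorem holderExponent_trichotomy_third (α : ℝ≥0) :
    (α : ℝ) < 1 / 3 ∨ (α : ℝ) = 1 / 3 ∨ (1 : ℝ) / 3 < α :=
  lt_trichotomy (α : ℝ) (1 / 3)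

end Literature.Analysis.FluidPDE
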